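import Literature.AlgebraicGeometry.Frobenioids.Cor411iiiOfFSMType
import Literature.AlgebraicGeometry.Frobenioids.Cor411iiAssemblyFSM
import Literature.AlgebraicGeometry.Frobenioids.EquivalenceThm34Assembly
import Literature.AlgebraicGeometry.Frobenioids.Prop55Sub
import HarnessLib

/-!
# Frobenioids I, Corollary 4.11 (iv) AS TYPED (`PreFrobenioidData.Cor411iv`) — the instance form AT THE
# CONSTRUCTIONS over bases of FSM-type, with NO residual hypothesis (FACT-LIST row F-1029)

Mochizuki, *The geometry of Frobenioids I: the general theory*, Kyushu J. Math. **62** (2008)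
293–400, kurims text: Cor. 4.11 (iv) statement p. 92, proof p. 94 ("In light of the structure of an
elementary Frobenioid [cf. Definition 1.1, (iii)], the existence of a 1-commutative diagram as in the
statement of assertion (iv) now follows simply by concatenating assertions (ii), (iii), with the fact that
`Ψ` preserves Frobenius degrees [cf. Theorem 3.4, (iii)]") [cite: MochizukiFrdI2008, Cor. 4.11 (iv) p.92].

PROOF-ONLY companion of `DivisorMonoidCategoryTheoreticity.lean` (seat abc-iut-f-033; FACT-LIST row F-1029
`PreFrobenioidData.Cor411iv`, [FrdI] Corollary 4.11 (iv) p. 92). Everything is assembled BY NAME from landed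
pieces; nothing is re-proved:

* `FrdI.cor411iv_ofFunctor_of_isOfFSMType` — the typed `(ofFunctor Φ₁ F₁).Cor411iv (ofFunctor Φ₂ F₂) Ψ R₁ R₂`
  for GENERAL Frobenioids `C_i → F_{Φ_i}` with perf-factorial `Φ_i` over bases of FSM-type and `C₁` of
  rational type at THE birationalization / THE support predicate (`hrat₁`), with the typed Cor. 4.11 (ii)
  DISCHARGED by `PreFrobenioid.cor411ii_ofFunctor_of_isOfFSMType` (seat abc-iut-L1-d6) and the printed case
  split: non-group-like case = `FrdI.cor411iv_of_cor411ii_of_isOfFSMType` (seat abc-iut-L1-t14); group-like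
  case = `FrdI.cor411iv_of_cor411ii_of_isOfGroupLikeType` fed with "`Ψ` preserves Frobenius degrees"
  (Thm. 3.4 (iv), `FrdI.preservesDegFr_ofFunctor_of_isOfFSMType`, seat abc-iut-L1-t13), whose clause "`Ψ`
  preserves `O^×(−)`" is read off the base square of Cor. 4.11 (ii) itself
  (`PreFrobenioid.isBaseIdentity_map_iff_of_square`);
* `PreFrobenioid.cor411iv_holds_of_isOfFSMType` — **the instance form AT THE CONSTRUCTIONS**: at the
  Def. 4.5 (iii) parameters `R₁ := PreFrobenioid.rsParams hF₁ PrimarySupp` (THE birationalization, THE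
  unit-trivialisation, THE support predicate of Def. 2.4 (i)(d)) the antecedent "`C₁` of rationally standard
  type" of the typed statement SUPPLIES `hrat₁` (Def. 4.5 (iii)(a): rational type), so the typed Cor. 4.11 (iv)
  holds with NO hypothesis beyond print's standing ones of §4 (`C_i → F_{Φ_i}` Frobenioids, `Φ_i`
  perf-factorial) and "bases of FSM-type" (the cell's standing route to Thm. 3.4 (ii)/(iii); every base
  category of [FrdI] §6, [FrdII] and [IUTchI] is of FSM-type);
* `PreFrobenioid.cor411iv_holds_of_isOfFSMType'` — the same with BOTH parameters at THE constructions.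

The universal closure of the schema `PreFrobenioidData.Cor411iv` over the data-only interfaces
`PreFrobenioidData` / `RSParams` is not a fact (junk instances; `DivisorMonoidCategoryTheoreticityFacts.lean`,
RQ7 audit F1/F2): the row is admissible AT THE CONSTRUCTIONS, which is what is proved here. No new
definitions; no statement of the paper is restated or strengthened; nothing here is specific to the abc
programme and no side is taken on [IUTchIII] Cor. 3.12.
-/

namespace Literature.AlgebraicGeometry.Frobenioids

open CategoryTheory Opposite

universe w v v' u u'

namespace FrdI

open PreFrobenioid

variable {D₁ : Type u} [Category.{v} D₁] {Φ₁ : D₁ᵒᵖ ⥤ CommMonCat.{w}} {C₁ : Type u'} [Category.{v'} C₁]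
  {D₂ : Type u} [Category.{v} D₂] {Φ₂ : D₂ᵒᵖ ⥤ CommMonCat.{w}} {C₂ : Type u'} [Category.{v'} C₂]
  {F₁ : C₁ ⥤ ElemFrobenioid Φ₁} {F₂ : C₂ ⥤ ElemFrobenioid Φ₂}

set_option backward.isDefEq.respectTransparency false in
/-- **"`Ψ` preserves `O^×(−)`" from the base square of Cor. 4.11 (ii)**: if the typed Cor. 4.11 (ii) holds for
`Ψ` and its setting is satisfied, then `Ψ` carries base-identity linear automorphisms to base-identity linear
automorphisms — `Base₂(Ψ α) = id` is read through `η : Base₂ ∘ Ψ ≅ Ψ^Base ∘ Base₁` with `Ψ^Base` an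
equivalence (faithful), and automorphisms are linear. [cite: MochizukiFrdI2008, Cor. 4.11 (ii) p.91] -/
theorem mapIso_mem_unitsSubgroup_of_cor411ii (Ψ : C₁ ≌ C₂)
    (h2 : (PreFrobenioidData.ofFunctor Φ₁ F₁).Cor411ii (PreFrobenioidData.ofFunctor Φ₂ F₂) Ψ)
    (hs : (PreFrobenioidData.ofFunctor Φ₁ F₁).Cor411Setting (PreFrobenioidData.ofFunctor Φ₂ F₂) Ψ)
    (A : C₁) (α : Aut A) (hα : α ∈ (PreFrobenioidData.ofFunctor Φ₁ F₁).unitsSubgroup A) :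
    Ψ.functor.mapIso α ∈ (PreFrobenioidData.ofFunctor Φ₂ F₂).unitsSubgroup (Ψ.functor.obj A) := by
  obtain ⟨ΨBase, ⟨hEq, ⟨η⟩, -⟩, -⟩ := h2 hs
  haveI := hEq
  rw [PreFrobenioidData.ofFunctor_unitsSubgroup] at hα ⊢
  exact ⟨(isBaseIdentity_map_iff_of_square F₁ F₂ Ψ ΨBase η α.hom).mpr hα.1, degFr_iso_hom F₂ _⟩

set_option backward.isDefEq.respectTransparency false in
/-- **[FrdI] Cor. 4.11 (iv) AS TYPED for general Frobenioids over bases of FSM-type** ("by concatenating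
assertions (ii), (iii), with the fact that `Ψ` preserves Frobenius degrees", p. 94): for Frobenioids
`C_i → F_{Φ_i}` with perf-factorial `Φ_i` over bases `D_i` of FSM-type, `C₁` of rational type at THE
birationalization and THE support predicate `PrimarySupp` (Def. 4.5 (ii)(iii), Def. 2.4 (i)(d)), and an
equivalence `Ψ : C₁ ⥲ C₂`, the typed `Cor411iv` holds (for arbitrary parameters `R_i`): Cor. 4.11 (ii) is
`PreFrobenioid.cor411ii_ofFunctor_of_isOfFSMType`; if `C₁` is not of group-like type the rest is
`FrdI.cor411iv_of_cor411ii_of_isOfFSMType` (Thm. 4.9's `Ψ^Φ` with its Div clause, Thm. 3.4 (iii)); if it is,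
`C₂` is too (Thm. 3.4 (ii), `FrdI.isOfGroupLikeType_map`), `Ψ^Φ` is trivial and "`Ψ` preserves Frobenius
degrees" is Thm. 3.4 (iv) (`FrdI.preservesDegFr_ofFunctor_of_isOfFSMType`, its `O^×`-clause from the base
square, `mapIso_mem_unitsSubgroup_of_cor411ii`). [cite: MochizukiFrdI2008, Cor. 4.11 (iv) p.92] -/
theorem cor411iv_ofFunctor_of_isOfFSMType (hF₁ : IsFrobenioid F₁) (hF₂ : IsFrobenioid F₂)
    (hD₁ : IsOfFSMType D₁) (hD₂ : IsOfFSMType D₂)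
    (hpf₁ : Objectwise (fun M _ => IsPerfFactorial M) Φ₁) (hpf₂ : Objectwise (fun M _ => IsPerfFactorial M) Φ₂)
    (hrat₁ : ∀ A : C₁, PreFrobenioidData.IsRational
      (biratData hF₁ (hasBiratSquares_of_isFrobenioid hF₁))
      (S := PreFrobenioidData.ofFunctor Φ₁ F₁) (fun a 𝔭 => PrimarySupp a 𝔭) A)
    (Ψ : C₁ ≌ C₂) (R₁ : (PreFrobenioidData.ofFunctor Φ₁ F₁).RSParams)
    (R₂ : (PreFrobenioidData.ofFunctor Φ₂ F₂).RSParams) :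
    (PreFrobenioidData.ofFunctor Φ₁ F₁).Cor411iv (PreFrobenioidData.ofFunctor Φ₂ F₂) Ψ R₁ R₂ := by
  intro hs hR₁ hR₂
  have h2 := cor411ii_ofFunctor_of_isOfFSMType hF₁ hF₂ Ψ hpf₁ hpf₂ hD₁ hD₂
  by_cases hg₁ : (PreFrobenioidData.ofFunctor Φ₁ F₁).IsOfGroupLikeType
  · -- group-like type on both sides: `Ψ^Φ` trivial, degrees by Thm. 3.4 (iv)
    have hg₂ : (PreFrobenioidData.ofFunctor Φ₂ F₂).IsOfGroupLikeType :=
      isOfGroupLikeType_map hF₁ hF₂ hs.standard.1.quasiIsotropic hs.standard.2.quasiIsotropic hD₁ hD₂ Ψ hg₁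
    have hdeg := preservesDegFr_ofFunctor_of_isOfFSMType hF₁ hF₂ hD₁ hD₂ Ψ hs.standard.1 hs.standard.2
      hs.hypB (mapIso_mem_unitsSubgroup_of_cor411ii Ψ h2 hs)
    exact cor411iv_of_cor411ii_of_isOfGroupLikeType hF₁ Ψ hg₁ hg₂ R₁ R₂ h2 hdeg hs hR₁ hR₂
  · exact cor411iv_of_cor411ii_of_isOfFSMType hF₁ hF₂ hD₁ hD₂ hpf₁ hpf₂ hg₁ hrat₁ Ψ R₁ R₂ h2 hs hR₁ hR₂

end FrdI

namespace PreFrobenioid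

variable {D₁ : Type u} [Category.{v} D₁] {Φ₁ : D₁ᵒᵖ ⥤ CommMonCat.{w}} {C₁ : Type u'} [Category.{v'} C₁]
  {D₂ : Type u} [Category.{v} D₂] {Φ₂ : D₂ᵒᵖ ⥤ CommMonCat.{w}} {C₂ : Type u'} [Category.{v'} C₂]
  {F₁ : C₁ ⥤ ElemFrobenioid Φ₁} {F₂ : C₂ ⥤ ElemFrobenioid Φ₂}

set_option backward.isDefEq.respectTransparency false in
/-- **[FrdI] Corollary 4.11 (iv) — FACT-LIST row F-1029 `PreFrobenioidData.Cor411iv`, the instance form AT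
THE CONSTRUCTIONS, NO residual hypothesis** (Category-theoreticity of the functor to an elementary Frobenioid
I, kurims p. 92): for Frobenioids `C_i → F_{Φ_i}` (Def. 1.3) with `Φ_i` perf-factorial (standing hypothesis of
§4) over base categories `D_i` of FSM-type and any equivalence `Ψ : C₁ ⥲ C₂`, the typed Cor. 4.11 (iv) holds
at the Def. 4.5 (iii) parameters `rsParams hF₁ PrimarySupp` of `C₁` (THE birationalization `C₁^birat` of
Prop. 4.4, THE unit-trivialisation `C₁^un-tr` of Prop. 3.3 (iv) with ITS birationalization, THE support
predicate of Def. 2.4 (i)(d)) and arbitrary parameters `R₂` of `C₂`: if `D_i` are Div-slim, `C_i` of standard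
type with hypothesis (b), and `C_i` of rationally standard type, then there are `Ψ^Base : D₁ ⥲ D₂`,
`Ψ^Φ : Φ₁ ⥲ Φ₂` over it and `η : Base₂ ∘ Ψ ≅ Ψ^Base ∘ Base₁` with `Ψ` preserving Frobenius degrees and
`Div(Ψ φ) = η_A^* Ψ^Φ(Div φ)` for every `φ : A → B` — the `1`-commutative diagram
`Ψ^F ∘ (C₁ → F_{Φ₁}) ≅ (C₂ → F_{Φ₂}) ∘ Ψ` — and, for slim `D_i`, rigid `D`-valued composites. The antecedent
"rationally standard" supplies "`C₁` of rational type" (Def. 4.5 (iii)(a)) at THE constructions, the residual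
input of `FrdI.cor411iv_ofFunctor_of_isOfFSMType`. [cite: MochizukiFrdI2008, Cor. 4.11 (iv) p.92] -/
theorem cor411iv_holds_of_isOfFSMType (hF₁ : IsFrobenioid F₁) (hF₂ : IsFrobenioid F₂)
    (hpf₁ : Objectwise (fun M _ => IsPerfFactorial M) Φ₁) (hpf₂ : Objectwise (fun M _ => IsPerfFactorial M) Φ₂)
    (hD₁ : IsOfFSMType D₁) (hD₂ : IsOfFSMType D₂) (Ψ : C₁ ≌ C₂)
    (R₂ : (PreFrobenioidData.ofFunctor Φ₂ F₂).RSParams) :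
    (PreFrobenioidData.ofFunctor Φ₁ F₁).Cor411iv (PreFrobenioidData.ofFunctor Φ₂ F₂) Ψ
      (rsParams hF₁ fun a 𝔭 => PrimarySupp a 𝔭) R₂ := fun hs hR₁ hR₂ =>
  FrdI.cor411iv_ofFunctor_of_isOfFSMType hF₁ hF₂ hD₁ hD₂ hpf₁ hpf₂ (fun A => hR₁.rational A) Ψ _ R₂ hs hR₁ hR₂

set_option backward.isDefEq.respectTransparency false in
/-- **[FrdI] Corollary 4.11 (iv), FACT-LIST row F-1029, BOTH parameters at THE constructions** (the shape in
which the cone quotes Def. 4.5 (iii): `C₁`, `C₂` of rationally standard type for THEIR birationalizations,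
unit-trivialisations and THE support predicate). [cite: MochizukiFrdI2008, Cor. 4.11 (iv) p.92] -/
theorem cor411iv_holds_of_isOfFSMType' (hF₁ : IsFrobenioid F₁) (hF₂ : IsFrobenioid F₂)
    (hpf₁ : Objectwise (fun M _ => IsPerfFactorial M) Φ₁) (hpf₂ : Objectwise (fun M _ => IsPerfFactorial M) Φ₂)
    (hD₁ : IsOfFSMType D₁) (hD₂ : IsOfFSMType D₂) (Ψ : C₁ ≌ C₂) :
    (PreFrobenioidData.ofFunctor Φ₁ F₁).Cor411iv (PreFrobenioidData.ofFunctor Φ₂ F₂) Ψ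
      (rsParams hF₁ fun a 𝔭 => PrimarySupp a 𝔭) (rsParams hF₂ fun a 𝔭 => PrimarySupp a 𝔭) :=
  cor411iv_holds_of_isOfFSMType hF₁ hF₂ hpf₁ hpf₂ hD₁ hD₂ Ψ _

end PreFrobenioid

end Literature.AlgebraicGeometry.Frobenioids
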